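import Literature.Computability.Complexity.GateEliminationClosed
import Literature.Computability.Complexity.GateEliminationAssignLin
import Literature.Computability.Complexity.GateEliminationTransfer
import Literature.Computability.Complexity.GateEliminationRegate

/-!
# Gate elimination: xor-reconstruction (Li–Yang Prop. 2.7, Prop. 2.8, constant substitution to a gate)

Circuit side of the "constant substitution to a gate" of Li–Yang (STOC 2022; full version
ECCC TR21-023, §2.6 *Substitution to gate: xor-reconstruction*, pp. 11–12), over the state space
`Semicircuit` / `RdqSource` / `Semicircuit.measure` of `GateEliminationStep.lean`, for the proof
of the one-step claim `LiYang2022_step` (used in Case 8 of §4.1). Everything is PROVED.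

* `Semicircuit.XorPath C i I` — a path `x_i = I₀ → I₁ → ⋯ → I_k = I` in the cyclic xor-part
  (printed p. 11, display (1)): gates `gate 0, …, gate len` of the xor-part, pairwise distinct,
  `gate 0` reading `x_i`, `gate (j+1)` reading `gate j`, `gate len = I`.
* **Prop. 2.7** (`Semicircuit.exists_xorPath`): if the gate `I` of the xor-part of a fair
  semicircuit depends on `x_i` (`DependsOn`), there is such a path — the printed proof: the gates
  of the xor-part unreachable from `x_i` form a closed sub-circuit not reading `x_i`, uniquely
  solvable by itself (`Fair.consistentOn_unique`), so their values do not depend on `x_i`; a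
  shortest walk is a path.
* **Xor-reconstruction** (`Semicircuit.reroute C p b`, Prop. 2.8 and Figure 7): the equations
  along the path are solved backwards ("`I_{j-1} = g_j(I_j, T_j)`"), the gate `I = I_k` becomes
  the constant `b`, and the variable `x_i` becomes a gate `Z` (placed in the slot of `I`)
  computing `g₁(I₁, T₁)`; every wire from `x_i` is moved to `Z` and every wire from `I` to the
  constant `b` (`Node.reroute`). Proved: it is a semicircuit with the same xor-part and the same
  number of gates; its gate equations are equivalent to the old ones with `I = b`
  (`consistent_reroute_iff`: "the system of linear equations corresponding to `C'` is equivalent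
  to that of `C`, while the only difference is that the output of `I` is fixed to be `b`"); it is
  **fair iff `I` depends on `x_i`** — `Fair.reroute`; `x_i` becomes a `0`-variable, `Z` inherits
  the other wires of `x_i`, out-degrees of the other variables and of the gates off the path are
  unchanged (`fanout_reroute_of_generic`), the constant `b` gains the readers of `I` and one
  path gate (`fanout_reroute_const_self`: `fanout'(b) = fanout(b) + fanout(I) + 1`, the "`b`
  feeding at least three gates" of Case 8.1.1), and **no troubled gate is created**
  (`troubled_of_troubled_reroute`), so a packing survives with no larger potential
  (`exists_packing_reroute`).
* **The source side and the measure** (§2.6 "Constant substitution to gate. If `I` depends on an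
  unprotected variable `x_i`, we can substitute `I ← b` … we further restrict `R` to `R'` by
  making `x_i` a linear variable with proper affine equation, and perform xor-reconstruction to
  `C` to obtain `C'` computing `f|_{R'}`"): the affine function computed at `I` gives the
  equation `x_i = ⊕_{s ∈ S ∖ {i}} x_s ⊕ c` (`gateLinEq`), `R' = R.assignLin i …`
  (`rerouteSource`), `dim R' + 1 = dim R`, `q` and the protected variables unchanged, and
  `ComputesRestr.reroute`: `C.reroute p b` computes `f|_{R'}`. Finally
  `measure_reroute_le`: `μ(C', 𝒫', R') ≤ μ(C, 𝒫, R) - α_I` (one gate removed and one added,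
  `x_i` no longer influential, `Φ' ≤ Φ`, `q' = q`).

## References

* J. Li, T. Yang, *3.1n − o(n) circuit lower bounds for explicit functions*, STOC 2022
  [LiYang2022]; full version ECCC TR21-023, §2.5 (fair semicircuits), §2.6 (Prop. 2.7, Prop. 2.8,
  xor-reconstruction, constant substitution to gate), §4.1 Case 8.
* M. G. Find, A. Golovnev, E. A. Hirsch, A. S. Kulikov, *A better-than-3n lower bound for the
  circuit complexity of an explicit function*, FOCS 2016 (xor-reconstruction).
-/

namespace Literature.Computability.Complexity

open Finset

namespace Semicircuit

variable {n : ℕ} (C : Semicircuit n)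

/-! ### Paths in the xor-part -/

/-- A **path in the cyclic xor-part from the variable `x_i` to the gate `I`** (Li–Yang §2.6,
display (1): `x_i = I₀ → I₁ → ⋯ → I_k = I`): gates `gate 0, …, gate len` of the xor-part,
pairwise distinct, `gate 0` reading `x_i` at position `pos 0`, `gate (j+1)` reading `gate j` at
position `pos (j+1)`, and `gate len = I`. [cite: LiYang2022, §2.6] -/
structure XorPath (i : Fin n) (I : Fin C.m) where
  /-- The number of gates on the path, minus one. -/
  len : ℕ
  /-- The gates `I₁, …, I_k` of the path (`k = len + 1`). -/
  gate : Fin (len + 1) → Fin C.m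
  /-- The position at which each gate reads its predecessor on the path. -/
  pos : Fin (len + 1) → Fin 2
  /-- The path ends at `I`. -/
  gate_last : gate (Fin.last len) = I
  /-- The path lies in the xor-part. -/
  mem_xorPart : ∀ j, gate j ∈ C.xorPart
  /-- The first gate reads `x_i`. -/
  arg_zero : C.arg (gate 0) (pos 0) = .var i
  /-- Each further gate reads its predecessor. -/
  arg_succ : ∀ j : Fin len, C.arg (gate j.succ) (pos j.succ) = .gate (gate j.castSucc)
  /-- The gates are pairwise distinct. -/
  injective : Function.Injective gate

namespace XorPath

variable {C} {i : Fin n} {I : Fin C.m} (p : C.XorPath i I)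

/-- The node read by the `t`-th gate of the path at its path position: `x_i` for `t = 0`, the
previous gate otherwise. [cite: LiYang2022, §2.6] -/
def src (t : Fin (p.len + 1)) : Node n C.m := C.arg (p.gate t) (p.pos t)

/-- The *other* input `T_t` of the `t`-th gate of the path. [cite: LiYang2022, §2.6] -/
def other (t : Fin (p.len + 1)) : Node n C.m := C.arg (p.gate t) (p.pos t).rev

/-- The constant of the ⊕-type function of the `t`-th gate: `op a b = a ⊕ b ⊕ const`. [folklore] -/
def const (t : Fin (p.len + 1)) : Bool := C.op (p.gate t) false false

/-- The source of the first gate is `x_i`. [folklore] -/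
theorem src_zero : p.src 0 = .var i := p.arg_zero

/-- The source of a later gate is the previous gate. [folklore] -/
theorem src_succ (j : Fin p.len) : p.src j.succ = .gate (p.gate j.castSucc) := p.arg_succ j

/-- The source of gate `t` is `x_i` or an earlier gate of the path. [folklore] -/
theorem src_eq (t : Fin (p.len + 1)) :
    p.src t = .var i ∨ ∃ j : Fin p.len, t = j.succ ∧ p.src t = .gate (p.gate j.castSucc) := by
  obtain rfl | ⟨j, rfl⟩ := t.eq_zero_or_eq_succ
  · exact Or.inl p.src_zero
  · exact Or.inr ⟨j, rfl, p.src_succ j⟩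

/-- The gates of the path are ⊕-type: `op a b = a ⊕ b ⊕ const`. [cite: LiYang2022, Def. 2.5] -/
theorem op_eq (t : Fin (p.len + 1)) (a b : Bool) : C.op (p.gate t) a b = ((a ^^ b) ^^ p.const t) := by
  obtain ⟨c, hc⟩ := C.isXorOp_of_mem _ (p.mem_xorPart t)
  have h0 : p.const t = c := by unfold const; rw [hc]; cases c <;> rfl
  rw [h0, hc]

/-- The two wires of the `t`-th gate are its source and its other input. [folklore] -/
theorem arg_eq_src_or_other (t : Fin (p.len + 1)) (a : Fin 2) :
    (a = p.pos t ∧ C.arg (p.gate t) a = p.src t) ∨ (a = (p.pos t).rev ∧ C.arg (p.gate t) a = p.other t) := by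
  unfold src other
  have hpos : p.pos t = 0 ∨ p.pos t = 1 := by
    generalize p.pos t = q; revert q; decide
  obtain rfl | rfl : a = 0 ∨ a = 1 := by fin_cases a <;> simp
  all_goals rcases hpos with h | h
  all_goals rw [h]
  · exact Or.inl ⟨rfl, rfl⟩
  · rw [show (1 : Fin 2).rev = 0 from by decide]; exact Or.inr ⟨rfl, rfl⟩
  · rw [show (0 : Fin 2).rev = 1 from by decide]; exact Or.inr ⟨rfl, rfl⟩
  · exact Or.inl ⟨rfl, rfl⟩

/-- **The gate equation of a path gate in symmetric form**: `I_t = src_t ⊕ T_t ⊕ c_t`.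
[cite: LiYang2022, §2.6 (display (1))] -/
theorem gateEq_iff (t : Fin (p.len + 1)) (x : Fin n → Bool) (w : Fin C.m → Bool) :
    C.GateEq x w (p.gate t) ↔
      w (p.gate t) = ((C.nodeVal x w (p.src t) ^^ C.nodeVal x w (p.other t)) ^^ p.const t) := by
  unfold GateEq
  rw [p.op_eq]
  unfold src other
  have hpos : p.pos t = 0 ∨ p.pos t = 1 := by
    generalize p.pos t = q; revert q; decide
  rcases hpos with h | h
  · rw [h, show (0 : Fin 2).rev = 1 from by decide]
  · rw [h, show (1 : Fin 2).rev = 0 from by decide, Bool.xor_comm (C.nodeVal x w (C.arg (p.gate t) 0))]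

/-- Distinct indices carry distinct gates. [folklore] -/
theorem gate_ne {s t : Fin (p.len + 1)} (h : s ≠ t) : p.gate s ≠ p.gate t := fun e => h (p.injective e)

/-- An earlier gate of the path is not `I`. [folklore] -/
theorem gate_castSucc_ne (j : Fin p.len) : p.gate j.castSucc ≠ I := fun e =>
  (Fin.castSucc_lt_last j).ne (p.injective (e.trans p.gate_last.symm))

/-- `I` is the last gate: `gate t = I ↔ t = last`. [folklore] -/
theorem gate_eq_last_iff (t : Fin (p.len + 1)) : p.gate t = I ↔ t = Fin.last p.len :=
  ⟨fun e => p.injective (e.trans p.gate_last.symm), fun e => e ▸ p.gate_last⟩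

/-- `I` lies in the xor-part. [folklore] -/
theorem last_mem_xorPart (p : C.XorPath i I) : I ∈ C.xorPart := by
  rw [← p.gate_last]; exact p.mem_xorPart _

end XorPath

/-! ### Walks, and Prop. 2.7: dependence gives a path -/

/-- There is a walk of length `L` in the xor-part from `x_i` to the gate `k`. [cite: LiYang2022, Prop. 2.7] -/
def WalkTo (i : Fin n) : ℕ → Fin C.m → Prop
  | 0, k => k ∈ C.xorPart ∧ ∃ a, C.arg k a = .var i
  | L + 1, k => k ∈ C.xorPart ∧ ∃ (a : Fin 2) (k' : Fin C.m), C.arg k a = .gate k' ∧ WalkTo i L k'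

variable {C} in
/-- A walk ends in the xor-part. [folklore] -/
theorem WalkTo.mem_xorPart {i : Fin n} : ∀ {L : ℕ} {k : Fin C.m}, C.WalkTo i L k → k ∈ C.xorPart
  | 0, _, h => h.1
  | _ + 1, _, h => h.1

/-- **A shortest walk is a path**: a walk of length `L` to `k`, with no shorter walk to `k`,
yields a path with `len = L` all of whose gates are reached by shortest walks of pairwise
different lengths (hence pairwise distinct). [folklore] -/
theorem exists_xorPath_of_walkTo (i : Fin n) :
    ∀ (L : ℕ) (k : Fin C.m), C.WalkTo i L k → (∀ L' < L, ¬ C.WalkTo i L' k) →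
      ∃ p : C.XorPath i k, p.len = L ∧
        ∀ j : Fin (p.len + 1), C.WalkTo i j (p.gate j) ∧ ∀ L' < (j : ℕ), ¬ C.WalkTo i L' (p.gate j)
  | 0, k, hk, hmin => by
    obtain ⟨hK, a, ha⟩ := hk
    refine ⟨{ len := 0, gate := fun _ => k, pos := fun _ => a, gate_last := rfl,
              mem_xorPart := fun _ => hK, arg_zero := ha, arg_succ := fun j => j.elim0,
              injective := fun s t _ => Fin.ext (by have := s.isLt; have := t.isLt; omega) }, rfl, fun j => ?_⟩
    have hj : (j : ℕ) = 0 := by have := j.isLt; dsimp only at this; omega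
    rw [hj]
    exact ⟨⟨hK, a, ha⟩, fun L' h => absurd h (Nat.not_lt_zero _)⟩
  | L + 1, k, hk, hmin => by
    obtain ⟨hK, a, k', ha, hk'⟩ := hk
    have hmin' : ∀ L' < L, ¬ C.WalkTo i L' k' := fun L' hL' h =>
      hmin (L' + 1) (by omega) ⟨hK, a, k', ha, h⟩
    obtain ⟨p, hlen, hgood⟩ := exists_xorPath_of_walkTo i L k' hk' hmin'
    subst hlen
    -- append `k` to the path `p`
    have hgood' : ∀ j : Fin (p.len + 1 + 1),
        C.WalkTo i j ((Fin.snoc p.gate k : Fin (p.len + 1 + 1) → Fin C.m) j) ∧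
          ∀ L' < (j : ℕ), ¬ C.WalkTo i L' ((Fin.snoc p.gate k : Fin (p.len + 1 + 1) → Fin C.m) j) := by
      intro j
      induction j using Fin.lastCases with
      | last =>
        rw [Fin.snoc_last, Fin.val_last]
        exact ⟨⟨hK, a, k', ha, hk'⟩, hmin⟩
      | cast j =>
        rw [Fin.snoc_castSucc, Fin.val_castSucc]
        exact hgood j
    refine ⟨{ len := p.len + 1, gate := Fin.snoc p.gate k, pos := Fin.snoc p.pos a,
              gate_last := by rw [Fin.snoc_last], mem_xorPart := fun j => (hgood' j).1.mem_xorPart,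
              arg_zero := ?_, arg_succ := ?_, injective := ?_ }, rfl, hgood'⟩
    · have h0 : (0 : Fin (p.len + 1 + 1)) = Fin.castSucc 0 := rfl
      rw [h0, Fin.snoc_castSucc, Fin.snoc_castSucc]
      exact p.arg_zero
    · intro j
      induction j using Fin.lastCases with
      | last =>
        rw [Fin.succ_last, Fin.snoc_last, Fin.snoc_last, Fin.snoc_castSucc, p.gate_last]
        exact ha
      | cast j =>
        simp only [Fin.succ_castSucc, Fin.snoc_castSucc]
        exact p.arg_succ j
    · intro s t hst
      by_contra hne
      rcases lt_or_gt_of_ne hne with hlt | hlt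
      · exact (hgood' t).2 s hlt (hst ▸ (hgood' s).1)
      · exact (hgood' s).2 t hlt (hst ▸ (hgood' t).1)


/-- **Dependence gives a walk** (the heart of Prop. 2.7): if the gate `I` of the xor-part depends
on `x_i`, some walk in the xor-part leads from `x_i` to `I` — otherwise the closed sub-circuit of
the gates unreachable from `x_i`, which does not read `x_i`, has the same (unique) solution before
and after flipping `x_i`. [cite: LiYang2022, Prop. 2.7] -/
theorem exists_walkTo_of_dependsOn (hF : C.Fair) {I : Fin C.m} (hI : I ∈ C.xorPart) {i : Fin n}
    (hdep : C.DependsOn hF I i) : ∃ L, C.WalkTo i L I := by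
  classical
  by_contra hno
  push Not at hno
  set U : Finset (Fin C.m) := univ.filter fun k => k ∈ C.xorPart ∧ ∀ L, ¬ C.WalkTo i L k with hU
  -- `U` (the gates of the xor-part unreachable from `x_i`) is closed
  have hUc : C.IsClosed U := by
    intro k hk a k' hk'
    rw [mem_filter] at hk ⊢
    exact ⟨mem_univ _, C.mem_of_arg_eq k hk.2.1 a k' hk', fun L hL => hk.2.2 (L + 1) ⟨hk.2.1, a, k', hk', hL⟩⟩
  have hIU : I ∈ U := mem_filter.mpr ⟨mem_univ _, hI, hno⟩
  let x : Fin n → Bool := fun _ => false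
  have h1 : C.ConsistentOn U x (C.sol hF x) := fun k _ => C.consistent_sol hF x k
  have h2 : C.ConsistentOn U x (C.sol hF (Function.update x i (!x i))) := by
    intro k hk
    have hk' := (mem_filter.mp hk).2
    have e := C.consistent_sol hF (Function.update x i (!x i)) k
    unfold GateEq
    rw [e]
    have hin : ∀ a, C.nodeVal (Function.update x i (!x i)) (C.sol hF (Function.update x i (!x i))) (C.arg k a) =
        C.nodeVal x (C.sol hF (Function.update x i (!x i))) (C.arg k a) := by
      intro a
      cases h : C.arg k a with
      | const c => rfl
      | var i' =>
        have hne : i' ≠ i := fun h' => hk'.2 0 ⟨hk'.1, a, by rw [h, h']⟩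
        show Function.update x i (!x i) i' = x i'
        exact Function.update_of_ne hne _ _
      | gate k' => rfl
    rw [hin 0, hin 1]
  exact hdep x (hF.consistentOn_unique hUc h2 h1 I hIU)

/-- **Prop. 2.7 of Li–Yang**: "Let `I` be a gate in a fair cyclic xor-circuit computing an affine
function that depends on `x_i`, then there exists a path from `x_i` to `I` in the circuit."
[cite: LiYang2022, Prop. 2.7] -/
theorem exists_xorPath (hF : C.Fair) {I : Fin C.m} (hI : I ∈ C.xorPart) {i : Fin n}
    (hdep : C.DependsOn hF I i) : Nonempty (C.XorPath i I) := by
  classical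
  have hex := C.exists_walkTo_of_dependsOn hF hI hdep
  obtain ⟨p, -, -⟩ := C.exists_xorPath_of_walkTo i (Nat.find hex) I (Nat.find_spec hex)
    fun L' hL' h => Nat.find_min hex hL' h
  exact ⟨p⟩

end Semicircuit

/-! ### The node substitution of xor-reconstruction -/

namespace Node

variable {n m : ℕ}

/-- The rewiring of xor-reconstruction: wires from the variable `x_i` go to the new gate `Z`
(which sits in the slot of `I`), wires from the gate `I` go to the constant `b`.
[cite: LiYang2022, §2.6 (Figure 7)] -/
def reroute (i : Fin n) (I : Fin m) (b : Bool) : Node n m → Node n m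
  | .const c => .const c
  | .var i' => if i' = i then .gate I else .var i'
  | .gate k => if k = I then .const b else .gate k

variable (i : Fin n) (I : Fin m) (b : Bool)

/-- Rerouting a constant. [folklore] -/
@[simp] theorem reroute_const (c : Bool) : (Node.const c : Node n m).reroute i I b = .const c := rfl

/-- Rerouting `x_i` gives `Z`. [folklore] -/
@[simp] theorem reroute_var_self : (Node.var i : Node n m).reroute i I b = .gate I := by
  simp [reroute]

/-- Other variables are kept. [folklore] -/
theorem reroute_var_of_ne {i' : Fin n} (h : i' ≠ i) : (Node.var i' : Node n m).reroute i I b = .var i' := by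
  simp [reroute, h]

/-- Rerouting `I` gives the constant. [folklore] -/
@[simp] theorem reroute_gate_self : (Node.gate I : Node n m).reroute i I b = .const b := by
  simp [reroute]

/-- Other gates are kept. [folklore] -/
theorem reroute_gate_of_ne {k : Fin m} (h : k ≠ I) : (Node.gate k : Node n m).reroute i I b = .gate k := by
  simp [reroute, h]

/-- `x_i` no longer occurs. [folklore] -/
theorem reroute_ne_var_self (u : Node n m) : u.reroute i I b ≠ .var i := by
  cases u with
  | const c => simp
  | var i' => by_cases h : i' = i <;> simp [reroute, h]
  | gate k => by_cases h : k = I <;> simp [reroute, h]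

/-- The result is the variable `x_{i'}` iff the node was, and `i' ≠ i`. [folklore] -/
theorem reroute_eq_var_iff {u : Node n m} {i' : Fin n} : u.reroute i I b = .var i' ↔ u = .var i' ∧ i' ≠ i := by
  cases u with
  | const c => simp
  | var j =>
    by_cases h : j = i
    · subst h; simp only [reroute_var_self, reduceCtorEq, Node.var.injEq, false_iff, not_and, not_not]
      exact fun e => e.symm
    · rw [reroute_var_of_ne i I b h]; simp only [Node.var.injEq]
      exact ⟨fun e => ⟨e, e ▸ h⟩, fun e => e.1⟩
  | gate k => by_cases h : k = I <;> simp [reroute, h]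

/-- The result is the gate `k ≠ I` iff the node was. [folklore] -/
theorem reroute_eq_gate_iff_of_ne {u : Node n m} {k : Fin m} (hk : k ≠ I) :
    u.reroute i I b = .gate k ↔ u = .gate k := by
  cases u with
  | const c => simp
  | var j => by_cases h : j = i <;> simp [reroute, h, hk.symm]
  | gate k' =>
    by_cases h : k' = I
    · subst h; simp [hk.symm]
    · rw [reroute_gate_of_ne i I b h]

/-- The result is `Z` iff the node was `x_i`. [folklore] -/
theorem reroute_eq_gate_self_iff {u : Node n m} : u.reroute i I b = .gate I ↔ u = .var i := by
  cases u with
  | const c => simp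
  | var j => by_cases h : j = i <;> simp [reroute, h]
  | gate k' => by_cases h : k' = I <;> simp [reroute, h]

/-- If the result is a gate `k`, then either the node was that gate (and `k ≠ I`) or the node was
`x_i` (and `k = I`). [folklore] -/
theorem eq_of_reroute_eq_gate {u : Node n m} {k : Fin m} (h : u.reroute i I b = .gate k) :
    (u = .gate k ∧ k ≠ I) ∨ (u = .var i ∧ k = I) := by
  by_cases hk : k = I
  · subst hk; exact Or.inr ⟨(reroute_eq_gate_self_iff i k b).mp h, rfl⟩
  · exact Or.inl ⟨(reroute_eq_gate_iff_of_ne i I b hk).mp h, hk⟩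

/-- A node other than `x_i`, the gates of a given family containing `I`, and the constants is
fixed, and is the image of itself only. [folklore] -/
theorem reroute_eq_iff_of_generic {v : Node n m} (hv : v ≠ .var i) (hvI : v ≠ .gate I)
    (hvc : ∀ c, v ≠ .const c) (u : Node n m) : u.reroute i I b = v ↔ u = v := by
  cases v with
  | const c => exact absurd rfl (hvc c)
  | var i' =>
    rw [reroute_eq_var_iff]
    exact ⟨fun h => h.1, fun h => ⟨h, fun e => hv (by rw [e])⟩⟩
  | gate k =>
    exact reroute_eq_gate_iff_of_ne i I b fun e => hvI (by rw [e])

end Node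

namespace Semicircuit

namespace XorPath

variable {n : ℕ} {C : Semicircuit n} {i : Fin n} {I : Fin C.m} (p : C.XorPath i I)

/-! ### Cyclic successor and predecessor on the path indices -/

/-- The cyclic successor of a path index (`last ↦ 0`). [folklore] -/
def next (j : Fin (p.len + 1)) : Fin (p.len + 1) :=
  Fin.lastCases (motive := fun _ => Fin (p.len + 1)) 0 (fun j₀ => j₀.succ) j

/-- The cyclic predecessor of a path index (`0 ↦ last`). [folklore] -/
def prev (t : Fin (p.len + 1)) : Fin (p.len + 1) :=
  Fin.cases (motive := fun _ => Fin (p.len + 1)) (Fin.last p.len) (fun j₀ => j₀.castSucc) t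

/-- `next last = 0`. [folklore] -/
@[simp] theorem next_last : p.next (Fin.last p.len) = 0 := by
  unfold next; rw [Fin.lastCases_last]

/-- `next (castSucc j) = succ j`. [folklore] -/
@[simp] theorem next_castSucc (j : Fin p.len) : p.next j.castSucc = j.succ := by
  unfold next; rw [Fin.lastCases_castSucc]

/-- `prev 0 = last`. [folklore] -/
@[simp] theorem prev_zero : p.prev 0 = Fin.last p.len := by
  unfold prev; rw [Fin.cases_zero]

/-- `prev (succ j) = castSucc j`. [folklore] -/
@[simp] theorem prev_succ (j : Fin p.len) : p.prev j.succ = j.castSucc := by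
  unfold prev; rw [Fin.cases_succ]

/-- `prev ∘ next = id`. [folklore] -/
@[simp] theorem prev_next (j : Fin (p.len + 1)) : p.prev (p.next j) = j := by
  induction j using Fin.lastCases with
  | last => rw [next_last, prev_zero]
  | cast j => rw [next_castSucc, prev_succ]

/-- `next ∘ prev = id`. [folklore] -/
@[simp] theorem next_prev (t : Fin (p.len + 1)) : p.next (p.prev t) = t := by
  obtain rfl | ⟨j, rfl⟩ := t.eq_zero_or_eq_succ
  · rw [prev_zero, next_last]
  · rw [prev_succ, next_castSucc]

/-- The cyclic successor as a permutation of the path indices. [folklore] -/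
def nextEquiv : Fin (p.len + 1) ≃ Fin (p.len + 1) where
  toFun := p.next
  invFun := p.prev
  left_inv := p.prev_next
  right_inv := p.next_prev

/-! ### The index of a gate on the path -/

open Classical in
/-- The index on the path of a gate, if it lies on the path. [folklore] -/
noncomputable def idx (k : Fin C.m) : Option (Fin (p.len + 1)) :=
  if h : ∃ j, p.gate j = k then some (Classical.choose h) else none

/-- The index of a path gate. [folklore] -/
theorem idx_gate (j : Fin (p.len + 1)) : p.idx (p.gate j) = some j := by
  unfold idx
  have h : ∃ j', p.gate j' = p.gate j := ⟨j, rfl⟩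
  rw [dif_pos h, Option.some.injEq]
  exact p.injective (Classical.choose_spec h)

/-- Gates off the path have no index. [folklore] -/
theorem idx_of_not_mem {k : Fin C.m} (h : ∀ j, p.gate j ≠ k) : p.idx k = none := by
  unfold idx
  rw [dif_neg (not_exists.mpr h)]

/-! ### The new circuit -/

/-- The gate functions after xor-reconstruction: the slot of the path gate of index `j` carries
the (⊕-type) function of the path gate of index `next j`, whose equation it solves; other gates
keep their function. [cite: LiYang2022, §2.6 (display (2))] -/
noncomputable def newOp (k : Fin C.m) : Bool → Bool → Bool :=
  match p.idx k with
  | none => C.op k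
  | some j => C.op (p.gate (p.next j))

/-- The wires after xor-reconstruction: the slot of the path gate of index `j` reads the path gate
of index `next j` (the constant `b` if that is `I`) and its other input `T`; other gates keep their
wires; throughout, `x_i` is replaced by `Z` and `I` by the constant `b`.
[cite: LiYang2022, §2.6 (display (2), Figure 7)] -/
noncomputable def newArg (b : Bool) (k : Fin C.m) (a : Fin 2) : Node n C.m :=
  match p.idx k with
  | none => (C.arg k a).reroute i I b
  | some j => if a = 0 then (Node.gate (p.gate (p.next j))).reroute i I b else (p.other (p.next j)).reroute i I b

variable (b : Bool)

/-- Gates off the path keep their function. [folklore] -/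
theorem newOp_of_not_mem {k : Fin C.m} (h : ∀ j, p.gate j ≠ k) : p.newOp k = C.op k := by
  unfold newOp; rw [p.idx_of_not_mem h]

/-- The function at the slot of the path gate of index `j`. [folklore] -/
theorem newOp_gate (j : Fin (p.len + 1)) : p.newOp (p.gate j) = C.op (p.gate (p.next j)) := by
  unfold newOp; rw [p.idx_gate j]

/-- Gates off the path keep their wires, rerouted. [folklore] -/
theorem newArg_of_not_mem {k : Fin C.m} (h : ∀ j, p.gate j ≠ k) (a : Fin 2) :
    p.newArg b k a = (C.arg k a).reroute i I b := by
  unfold newArg; rw [p.idx_of_not_mem h]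

/-- The first wire at the slot of the path gate of index `j`. [folklore] -/
theorem newArg_gate_zero (j : Fin (p.len + 1)) :
    p.newArg b (p.gate j) 0 = (Node.gate (p.gate (p.next j))).reroute i I b := by
  unfold newArg; rw [p.idx_gate j]; rfl

/-- The second wire at the slot of the path gate of index `j`. [folklore] -/
theorem newArg_gate_one (j : Fin (p.len + 1)) :
    p.newArg b (p.gate j) 1 = (p.other (p.next j)).reroute i I b := by
  unfold newArg; rw [p.idx_gate j]; rfl

/-- A new wire that is a gate was a gate wire of a gate of `C` (or of the path), or is `Z = I`.
[folklore] -/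
theorem mem_xorPart_of_newArg_eq_gate {k : Fin C.m} {a : Fin 2} {k' : Fin C.m}
    (h : p.newArg b k a = .gate k') (hk : ∀ k'', (∃ a', C.arg k a' = .gate k'') → k'' ∈ C.xorPart) :
    k' ∈ C.xorPart := by
  by_cases hmem : ∃ j, p.gate j = k
  · obtain ⟨j, rfl⟩ := hmem
    obtain rfl | rfl : a = 0 ∨ a = 1 := by fin_cases a <;> simp
    · rw [newArg_gate_zero] at h
      rcases Node.eq_of_reroute_eq_gate i I b h with ⟨e, -⟩ | ⟨e, rfl⟩
      · cases e; exact p.mem_xorPart _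
      · exact p.last_mem_xorPart
    · rw [newArg_gate_one] at h
      rcases Node.eq_of_reroute_eq_gate i I b h with ⟨e, -⟩ | ⟨-, rfl⟩
      · exact C.mem_of_arg_eq _ (p.mem_xorPart _) _ k' e
      · exact p.last_mem_xorPart
  · push Not at hmem
    rw [p.newArg_of_not_mem b hmem] at h
    rcases Node.eq_of_reroute_eq_gate i I b h with ⟨e, -⟩ | ⟨-, rfl⟩
    · exact hk k' ⟨a, e⟩
    · exact p.last_mem_xorPart

end XorPath

variable {n : ℕ} (C : Semicircuit n)

/-- **Xor-reconstruction** `C[I := b]` along the path `p` from `x_i` to `I` (Li–Yang §2.6,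
Prop. 2.8, Figure 7: "replace the gate `I_k` with a constant `b`, replace the variable `x_i` with a
gate `Z`, and rewire the circuit according to this system of linear equations"): same gates (the
slot of `I` now holding `Z`), the path equations solved backwards, `x_i ↦ Z` and `I ↦ b` in all
wires and in the output. [cite: LiYang2022, §2.6, Prop. 2.8] -/
noncomputable abbrev reroute {i : Fin n} {I : Fin C.m} (p : C.XorPath i I) (b : Bool) : Semicircuit n where
  m := C.m
  op := p.newOp
  arg := p.newArg b
  out := C.out.reroute i I b
  xorPart := C.xorPart
  isXorOp_of_mem k hk := by
    by_cases h : ∃ j, p.gate j = k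
    · obtain ⟨j, rfl⟩ := h
      rw [p.newOp_gate]
      exact C.isXorOp_of_mem _ (p.mem_xorPart _)
    · push Not at h
      rw [p.newOp_of_not_mem h]
      exact C.isXorOp_of_mem k hk
  mem_of_arg_eq k hk a k' hk' :=
    p.mem_xorPart_of_newArg_eq_gate b hk' fun k'' ⟨a', ha'⟩ => C.mem_of_arg_eq k hk a' k'' ha'
  acyclic := by
    refine ⟨C.rank, fun k hk a k' hk' hk'K => ?_⟩
    have hkp : ∀ j, p.gate j ≠ k := fun j e => hk (e ▸ p.mem_xorPart j)
    rw [p.newArg_of_not_mem b hkp] at hk'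
    rcases Node.eq_of_reroute_eq_gate i I b hk' with ⟨e, -⟩ | ⟨-, rfl⟩
    · exact C.rank_lt hk e hk'K
    · exact absurd p.last_mem_xorPart hk'K

section Reroute

variable {C} {i : Fin n} {I : Fin C.m} (p : C.XorPath i I) (b : Bool)

/-- Same number of gates. [cite: LiYang2022, §2.6] -/
@[simp] theorem reroute_m : (C.reroute p b).m = C.m := rfl

/-- Same xor-part. [cite: LiYang2022, Prop. 2.8] -/
@[simp] theorem reroute_xorPart : (C.reroute p b).xorPart = C.xorPart := rfl

/-- The output after xor-reconstruction. [folklore] -/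
theorem reroute_out : (C.reroute p b).out = C.out.reroute i I b := rfl

/-- Wires of gates off the path. [folklore] -/
theorem reroute_arg_of_not_mem {k : Fin C.m} (h : ∀ j, p.gate j ≠ k) (a : Fin 2) :
    (C.reroute p b).arg k a = (C.arg k a).reroute i I b :=
  p.newArg_of_not_mem b h a

/-- Functions of gates off the path. [folklore] -/
theorem reroute_op_of_not_mem {k : Fin C.m} (h : ∀ j, p.gate j ≠ k) : (C.reroute p b).op k = C.op k :=
  p.newOp_of_not_mem h

/-- First wire at a path slot. [folklore] -/
theorem reroute_arg_gate_zero (j : Fin (p.len + 1)) :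
    (C.reroute p b).arg (p.gate j) 0 = (Node.gate (p.gate (p.next j))).reroute i I b :=
  p.newArg_gate_zero b j

/-- Second wire at a path slot. [folklore] -/
theorem reroute_arg_gate_one (j : Fin (p.len + 1)) :
    (C.reroute p b).arg (p.gate j) 1 = (p.other (p.next j)).reroute i I b :=
  p.newArg_gate_one b j

/-- Function at a path slot. [folklore] -/
theorem reroute_op_gate (j : Fin (p.len + 1)) : (C.reroute p b).op (p.gate j) = C.op (p.gate (p.next j)) :=
  p.newOp_gate j

/-- A gate off the path is not `I`. [folklore] -/
theorem ne_last_of_not_mem {k : Fin C.m} (h : ∀ j, p.gate j ≠ k) : k ≠ I :=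
  fun e => h (Fin.last _) (p.gate_last.trans e.symm)

/-! #### Semantics: the gate equations are the old ones with `I = b` -/

/-- Node values are computed by the same function. [folklore] -/
theorem nodeVal_reroute_eq (x : Fin n → Bool) (w : Fin C.m → Bool) (u : Node n C.m) :
    (C.reroute p b).nodeVal x w u = C.nodeVal x w u := by
  cases u <;> rfl

/-- **Values of rerouted nodes**: the value of `σ(u)` in the new circuit on `(x', w')` is the
value of `u` in the old circuit on the input with `x_i := w'(Z)` and the gate values with
`I := b`. [cite: LiYang2022, Prop. 2.8 (proof)] -/
theorem nodeVal_reroute (x' : Fin n → Bool) (w' : Fin C.m → Bool) (u : Node n C.m) :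
    C.nodeVal x' w' (u.reroute i I b) =
      C.nodeVal (Function.update x' i (w' I)) (Function.update w' I b) u := by
  cases u with
  | const c => rfl
  | var i' =>
    by_cases h : i' = i
    · subst h
      rw [Node.reroute_var_self]
      show w' I = Function.update x' i' (w' I) i'
      rw [Function.update_self]
    · rw [Node.reroute_var_of_ne i I b h]
      show x' i' = Function.update x' i (w' I) i'
      rw [Function.update_of_ne h]
  | gate k =>
    by_cases h : k = I
    · subst h
      rw [Node.reroute_gate_self]
      show b = Function.update w' k b k
      rw [Function.update_self]
    · rw [Node.reroute_gate_of_ne i I b h]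
      show w' k = Function.update w' I b k
      rw [Function.update_of_ne h]

/-- Xor algebra: `s = (g ⊕ o) ⊕ c ↔ g = (s ⊕ o) ⊕ c`. [folklore] -/
theorem xor_solve (s g o c : Bool) : s = ((g ^^ o) ^^ c) ↔ g = ((s ^^ o) ^^ c) := by
  cases s <;> cases g <;> cases o <;> cases c <;> decide

/-- **Prop. 2.8, the equations**: the gate equations of `C[I := b]` on `(x', w')` are exactly the
gate equations of `C` on the input with `x_i := w'(Z)` and the values with `I := b` ("the system
of linear equations corresponding to `C'` is equivalent to that of `C`, while the only difference
is that the output of `I` is fixed to be `b`"). [cite: LiYang2022, Prop. 2.8] -/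
theorem consistent_reroute_iff (x' : Fin n → Bool) (w' : Fin C.m → Bool) :
    (C.reroute p b).Consistent x' w' ↔
      C.Consistent (Function.update x' i (w' I)) (Function.update w' I b) := by
  set x := Function.update x' i (w' I) with hx
  set w := Function.update w' I b with hw
  -- the new value at the slot `prev t` is the old value of the source of `t`
  have hslot : ∀ t, C.nodeVal x w (p.src t) = w' (p.gate (p.prev t)) := by
    intro t
    obtain rfl | ⟨j, rfl⟩ := t.eq_zero_or_eq_succ
    · rw [p.src_zero, p.prev_zero, p.gate_last]
      show x i = w' I
      rw [hx, Function.update_self]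
    · rw [p.src_succ, p.prev_succ]
      show w (p.gate j.castSucc) = _
      rw [hw, Function.update_of_ne (p.gate_castSucc_ne j)]
  -- the new equation at the slot `prev t`, read in the old circuit
  have hnew : ∀ t, (w' (p.gate (p.prev t)) = (C.reroute p b).op (p.gate (p.prev t))
      ((C.reroute p b).nodeVal x' w' ((C.reroute p b).arg (p.gate (p.prev t)) 0))
      ((C.reroute p b).nodeVal x' w' ((C.reroute p b).arg (p.gate (p.prev t)) 1))) ↔
        C.GateEq x w (p.gate t) := by
    intro t
    rw [reroute_op_gate, reroute_arg_gate_zero, reroute_arg_gate_one, p.next_prev, nodeVal_reroute_eq,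
      nodeVal_reroute_eq, nodeVal_reroute, nodeVal_reroute, ← hx, ← hw, p.op_eq, ← hslot, p.gateEq_iff]
    show C.nodeVal x w (p.src t) = ((w (p.gate t) ^^ _) ^^ _) ↔ _
    exact xor_solve _ _ _ _
  -- the new equation at a gate off the path, read in the old circuit
  have hoff : ∀ k, (∀ j, p.gate j ≠ k) → ((w' k = (C.reroute p b).op k
      ((C.reroute p b).nodeVal x' w' ((C.reroute p b).arg k 0))
      ((C.reroute p b).nodeVal x' w' ((C.reroute p b).arg k 1))) ↔ C.GateEq x w k) := by
    intro k hk
    rw [reroute_op_of_not_mem p b hk, reroute_arg_of_not_mem p b hk, reroute_arg_of_not_mem p b hk,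
      nodeVal_reroute_eq, nodeVal_reroute_eq, nodeVal_reroute, nodeVal_reroute, ← hx, ← hw]
    unfold GateEq
    rw [show w k = w' k from Function.update_of_ne (ne_last_of_not_mem p hk) _ _]
  constructor
  · intro h k
    by_cases hk : ∃ t, p.gate t = k
    · obtain ⟨t, rfl⟩ := hk
      exact (hnew t).mp (h _)
    · push Not at hk
      exact (hoff k hk).mp (h k)
  · intro h k
    by_cases hk : ∃ j, p.gate j = k
    · obtain ⟨j, rfl⟩ := hk
      have := (hnew (p.next j)).mpr (h _)
      rwa [p.prev_next] at this
    · push Not at hk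
      exact (hoff k hk).mpr (h k)

/-- **Prop. 2.8, fairness**: if `C` is fair and `I` depends on `x_i`, then `C[I := b]` is fair —
on every input exactly one value `t` of `x_i` makes `I = b`, and the solution of `C` there, with
`Z := t`, is the unique solution. [cite: LiYang2022, Prop. 2.8] -/
theorem Fair.reroute (hF : C.Fair) (hdep : C.DependsOn hF I i) : (C.reroute p b).Fair := by
  intro x'
  have key : ∀ t, C.sol hF (Function.update x' i (!t)) I ≠ C.sol hF (Function.update x' i t) I := by
    intro t
    have := hdep (Function.update x' i t)
    rwa [Function.update_self, Function.update_idem] at this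
  obtain ⟨t₀, ht₀⟩ : ∃ t₀, C.sol hF (Function.update x' i t₀) I = b := by
    by_cases h : C.sol hF (Function.update x' i false) I = b
    · exact ⟨false, h⟩
    · refine ⟨true, ?_⟩
      have h' := key false
      rw [Bool.not_false] at h'
      revert h h'
      generalize C.sol hF (Function.update x' i false) I = α
      generalize C.sol hF (Function.update x' i true) I = β
      cases α <;> cases β <;> cases b <;> decide
  refine ⟨Function.update (C.sol hF (Function.update x' i t₀)) I t₀, ?_, ?_⟩
  · show (C.reroute p b).Consistent x' _
    rw [consistent_reroute_iff, Function.update_self, Function.update_idem, ← ht₀, Function.update_eq_self]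
    exact C.consistent_sol hF _
  · intro w' hw'
    rw [consistent_reroute_iff] at hw'
    have hw : Function.update w' I b = C.sol hF (Function.update x' i (w' I)) := hw'.eq_sol hF
    have hIb : C.sol hF (Function.update x' i (w' I)) I = b := by rw [← hw, Function.update_self]
    have ht : w' I = t₀ := by
      by_contra hne
      have e : w' I = !t₀ := by
        revert hne; generalize w' I = α; cases α <;> cases t₀ <;> decide
      exact key t₀ (by rw [← e, hIb, ht₀])
    calc w' = Function.update (Function.update w' I b) I (w' I) := by
          rw [Function.update_idem, Function.update_eq_self]
      _ = Function.update (C.sol hF (Function.update x' i t₀)) I t₀ := by rw [hw, ht]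

/-! #### Out-degrees after xor-reconstruction -/

/-- A wire to `v` makes the out-degree of `v` positive. [folklore] -/
theorem fanout_pos_of_arg_eq {D : Semicircuit n} {k : Fin D.m} {a : Fin 2} {v : Node n D.m}
    (h : D.arg k a = v) : 0 < D.fanout v := by
  classical
  unfold fanout
  have h1 : 0 < (univ.filter fun a' : Fin 2 => D.arg k a' = v).card :=
    card_pos.mpr ⟨a, mem_filter.mpr ⟨mem_univ _, h⟩⟩
  exact lt_of_lt_of_le h1 (single_le_sum (f := fun j => (univ.filter fun a' : Fin 2 => D.arg j a' = v).card)
    (fun _ _ => Nat.zero_le _) (mem_univ k))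

/-- **Every new wire is a rerouted old wire or a rerouted path gate.** [folklore] -/
theorem reroute_arg_cases (k : Fin C.m) (a : Fin 2) :
    (∃ (k' : Fin C.m) (a' : Fin 2), (C.reroute p b).arg k a = (C.arg k' a').reroute i I b) ∨
      ∃ t, (C.reroute p b).arg k a = (Node.gate (p.gate t)).reroute i I b := by
  by_cases hk : ∃ j, p.gate j = k
  · obtain ⟨j, rfl⟩ := hk
    obtain rfl | rfl : a = 0 ∨ a = 1 := by fin_cases a <;> simp
    · exact Or.inr ⟨_, reroute_arg_gate_zero p b j⟩
    · exact Or.inl ⟨_, _, reroute_arg_gate_one p b j⟩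
  · push Not at hk
    exact Or.inl ⟨k, a, reroute_arg_of_not_mem p b hk a⟩

/-- **`x_i` becomes a `0`-variable.** [cite: LiYang2022, §2.6] -/
theorem fanout_reroute_var_self : (C.reroute p b).fanout (.var i) = 0 := by
  unfold fanout
  refine sum_eq_zero fun k _ => ?_
  rw [card_eq_zero, filter_eq_empty_iff]
  intro a _ h
  rcases reroute_arg_cases p b k a with ⟨k', a', e⟩ | ⟨t, e⟩
  · exact Node.reroute_ne_var_self i I b _ (e ▸ h)
  · exact Node.reroute_ne_var_self i I b _ (e ▸ h)

/-- A `0`-variable stays a `0`-variable. [folklore] -/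
theorem fanout_reroute_var_eq_zero {j : Fin n} (h0 : C.fanout (.var j) = 0) :
    (C.reroute p b).fanout (.var j) = 0 := by
  by_cases hji : j = i
  · subst hji; exact fanout_reroute_var_self p b
  unfold fanout
  refine sum_eq_zero fun k _ => ?_
  rw [card_eq_zero, filter_eq_empty_iff]
  intro a _ h
  rcases reroute_arg_cases p b k a with ⟨k', a', e⟩ | ⟨t, e⟩
  · rw [e, Node.reroute_eq_var_iff] at h
    exact (fanout_pos_of_arg_eq h.1).ne' h0
  · rw [e, Node.reroute_eq_var_iff] at h
    exact absurd h.1 (by simp)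

/-- `x_i` is read by the first gate of the path: it is a `1⁺`-variable. [folklore] -/
theorem XorPath.one_le_fanout_var (p : C.XorPath i I) : 1 ≤ C.fanout (.var i) := fanout_pos_of_arg_eq p.arg_zero

/-- Splitting a sum over the gates into the gates off the path and the path slots. [folklore] -/
theorem XorPath.sum_split (F : Fin C.m → ℕ) :
    ∑ k, F k = (∑ k ∈ univ.filter (fun k => ∀ t, p.gate t ≠ k), F k) + ∑ t, F (p.gate t) := by
  classical
  rw [← sum_filter_add_sum_filter_not univ (fun k => ∀ t, p.gate t ≠ k) F]
  congr 1
  have himg : univ.filter (fun k => ¬ ∀ t, p.gate t ≠ k) = univ.image p.gate := by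
    ext k
    simp only [mem_filter, mem_univ, true_and, mem_image, not_forall, not_not]
  rw [himg, sum_image fun s _ t _ h => p.injective h]

/-- The source of a path gate is `x_i` or a path gate. [folklore] -/
theorem XorPath.src_ne {v : Node n C.m} (hv : v ≠ .var i) (hvp : ∀ t, v ≠ .gate (p.gate t))
    (t : Fin (p.len + 1)) : p.src t ≠ v := by
  rcases p.src_eq t with h | ⟨j, -, h⟩
  · rw [h]; exact fun e => hv e.symm
  · rw [h]; exact fun e => hvp _ e.symm

/-- **Out-degrees of nodes off the path are unchanged** (variables other than `x_i`, gates not on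
the path): the `T`-wires of the path are kept, its internal wires are permuted among path gates.
[cite: LiYang2022, §2.6 (Figure 7)] -/
theorem fanout_reroute_of_generic {v : Node n C.m} (hv : v ≠ .var i) (hvp : ∀ t, v ≠ .gate (p.gate t))
    (hvc : ∀ c, v ≠ .const c) : (C.reroute p b).fanout v = C.fanout v := by
  classical
  have hvI : v ≠ .gate I := p.gate_last ▸ hvp (Fin.last _)
  unfold fanout
  rw [p.sum_split fun k => (univ.filter fun a : Fin 2 => (C.reroute p b).arg k a = v).card,
    p.sum_split fun k => (univ.filter fun a : Fin 2 => C.arg k a = v).card]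
  congr 1
  · refine sum_congr rfl fun k hk => ?_
    rw [mem_filter] at hk
    congr 1
    refine filter_congr fun a _ => ?_
    rw [reroute_arg_of_not_mem p b hk.2, Node.reroute_eq_iff_of_generic i I b hv hvI hvc]
  · calc ∑ j, (univ.filter fun a : Fin 2 => (C.reroute p b).arg (p.gate j) a = v).card
        = ∑ j, (univ.filter fun a : Fin 2 => a = 1 ∧ p.other (p.next j) = v).card := by
          refine sum_congr rfl fun j _ => ?_
          congr 1
          refine filter_congr fun a _ => ?_
          obtain rfl | rfl : a = 0 ∨ a = 1 := by fin_cases a <;> simp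
          · rw [reroute_arg_gate_zero]
            simp only [zero_ne_one, false_and, iff_false]
            intro h
            by_cases hg : p.gate (p.next j) = I
            · rw [hg, Node.reroute_gate_self] at h; exact hvc b h.symm
            · rw [Node.reroute_gate_of_ne i I b hg] at h; exact hvp _ h.symm
          · rw [reroute_arg_gate_one, Node.reroute_eq_iff_of_generic i I b hv hvI hvc]
            simp only [true_and]
      _ = ∑ t, (univ.filter fun a : Fin 2 => a = 1 ∧ p.other t = v).card :=
          p.nextEquiv.sum_comp fun t => (univ.filter fun a : Fin 2 => a = 1 ∧ p.other t = v).card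
      _ = ∑ t, (univ.filter fun a : Fin 2 => C.arg (p.gate t) a = v).card := by
          refine sum_congr rfl fun t _ => ?_
          by_cases ho : p.other t = v
          · have hl : (univ.filter fun a : Fin 2 => a = 1 ∧ p.other t = v) = {1} := by
              ext a; simp [ho]
            have hr : (univ.filter fun a : Fin 2 => C.arg (p.gate t) a = v) = {(p.pos t).rev} := by
              ext a
              simp only [mem_filter, mem_univ, true_and, mem_singleton]
              rcases p.arg_eq_src_or_other t a with ⟨ha, he⟩ | ⟨ha, he⟩
              · rw [he]
                refine ⟨fun h => absurd h (p.src_ne hv hvp t), fun h => ?_⟩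
                exact absurd (ha.symm.trans h) (fin2_ne_rev _)
              · rw [he]; exact ⟨fun _ => ha, fun _ => ho⟩
            rw [hl, hr, card_singleton, card_singleton]
          · have hl : (univ.filter fun a : Fin 2 => a = 1 ∧ p.other t = v) = ∅ := by
              ext a; simp [ho]
            have hr : (univ.filter fun a : Fin 2 => C.arg (p.gate t) a = v) = ∅ := by
              ext a
              simp only [mem_filter, mem_univ, true_and, Finset.notMem_empty, iff_false]
              rcases p.arg_eq_src_or_other t a with ⟨-, he⟩ | ⟨-, he⟩
              · rw [he]; exact p.src_ne hv hvp t
              · rw [he]; exact ho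
            rw [hl, hr]

/-- **`Z` inherits the wires of `x_i` but the one into the first path gate**:
`fanout'(Z) + 1 = fanout(x_i)`. [cite: LiYang2022, §2.6 (Figure 7)] -/
theorem fanout_reroute_gate_last_add_one : (C.reroute p b).fanout (.gate I) + 1 = C.fanout (.var i) := by
  classical
  unfold fanout
  rw [p.sum_split fun k => (univ.filter fun a : Fin 2 => (C.reroute p b).arg k a = Node.gate I).card,
    p.sum_split fun k => (univ.filter fun a : Fin 2 => C.arg k a = Node.var i).card, add_assoc]
  congr 1
  · refine sum_congr rfl fun k hk => ?_
    rw [mem_filter] at hk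
    congr 1
    refine filter_congr fun a _ => ?_
    rw [reroute_arg_of_not_mem p b hk.2, Node.reroute_eq_gate_self_iff]
  · -- on the path: new wires to `Z` are the `T`-wires from `x_i`; old wires to `x_i` are those and
    -- the path wire of the first gate
    have hnew : ∑ j, (univ.filter fun a : Fin 2 => (C.reroute p b).arg (p.gate j) a = Node.gate I).card
        = ∑ t, (univ.filter fun a : Fin 2 => a = 1 ∧ p.other t = Node.var i).card := by
      calc ∑ j, (univ.filter fun a : Fin 2 => (C.reroute p b).arg (p.gate j) a = Node.gate I).card
          = ∑ j, (univ.filter fun a : Fin 2 => a = 1 ∧ p.other (p.next j) = Node.var i).card := by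
            refine sum_congr rfl fun j _ => ?_
            congr 1
            refine filter_congr fun a _ => ?_
            obtain rfl | rfl : a = 0 ∨ a = 1 := by fin_cases a <;> simp
            · rw [reroute_arg_gate_zero, Node.reroute_eq_gate_self_iff]
              simp
            · rw [reroute_arg_gate_one, Node.reroute_eq_gate_self_iff]
              simp only [true_and]
        _ = ∑ t, (univ.filter fun a : Fin 2 => a = 1 ∧ p.other t = Node.var i).card :=
            p.nextEquiv.sum_comp fun t => (univ.filter fun a : Fin 2 => a = 1 ∧ p.other t = Node.var i).card
    have hold : ∀ t, (univ.filter fun a : Fin 2 => C.arg (p.gate t) a = Node.var i).card =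
        (univ.filter fun a : Fin 2 => a = 1 ∧ p.other t = Node.var i).card + (if t = 0 then 1 else 0) := by
      intro t
      -- the wire at the path position is `x_i` iff `t = 0`
      have hsrc : p.src t = Node.var i ↔ t = 0 := by
        constructor
        · intro h
          rcases p.src_eq t with h' | ⟨j, rfl, h'⟩
          · by_contra ht
            obtain ⟨j, rfl⟩ := Fin.exists_succ_eq.mpr ht
            rw [p.src_succ] at h; cases h
          · rw [h'] at h; cases h
        · rintro rfl; exact p.src_zero
      have hsplit : (univ.filter fun a : Fin 2 => C.arg (p.gate t) a = Node.var i) =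
          (univ.filter fun a : Fin 2 => a = (p.pos t).rev ∧ p.other t = Node.var i) ∪
            (univ.filter fun a : Fin 2 => a = p.pos t ∧ p.src t = Node.var i) := by
        ext a
        simp only [mem_filter, mem_univ, true_and, mem_union]
        rcases p.arg_eq_src_or_other t a with ⟨ha, he⟩ | ⟨ha, he⟩
        · rw [he]
          refine ⟨fun h => Or.inr ⟨ha, h⟩, ?_⟩
          rintro (⟨ha', h⟩ | ⟨-, h⟩)
          · exact absurd (ha.symm.trans ha') (fin2_ne_rev _)
          · exact h
        · rw [he]
          refine ⟨fun h => Or.inl ⟨ha, h⟩, ?_⟩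
          rintro (⟨-, h⟩ | ⟨ha', h⟩)
          · exact h
          · exact absurd (ha'.symm.trans ha) (fin2_ne_rev _)
      have hdisj : Disjoint (univ.filter fun a : Fin 2 => a = (p.pos t).rev ∧ p.other t = Node.var i)
          (univ.filter fun a : Fin 2 => a = p.pos t ∧ p.src t = Node.var i) := by
        rw [disjoint_filter]
        rintro a - ⟨ha, -⟩ ⟨ha', -⟩
        exact fin2_ne_rev _ (ha'.symm.trans ha)
      rw [hsplit, card_union_of_disjoint hdisj]
      congr 1
      · -- both count `[other t = x_i]`
        by_cases ho : p.other t = Node.var i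
        · rw [show (univ.filter fun a : Fin 2 => a = (p.pos t).rev ∧ p.other t = Node.var i) = {(p.pos t).rev} by
              ext a; simp [ho],
            show (univ.filter fun a : Fin 2 => a = 1 ∧ p.other t = Node.var i) = {1} by ext a; simp [ho],
            card_singleton, card_singleton]
        · rw [show (univ.filter fun a : Fin 2 => a = (p.pos t).rev ∧ p.other t = Node.var i) = ∅ by
              ext a; simp [ho],
            show (univ.filter fun a : Fin 2 => a = 1 ∧ p.other t = Node.var i) = ∅ by ext a; simp [ho]]
      · by_cases ht : t = 0
        · rw [if_pos ht, show (univ.filter fun a : Fin 2 => a = p.pos t ∧ p.src t = Node.var i) = {p.pos t} by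
            ext a; simp [hsrc.mpr ht], card_singleton]
        · have hns : ¬ p.src t = Node.var i := fun h => ht (hsrc.mp h)
          rw [if_neg ht, show (univ.filter fun a : Fin 2 => a = p.pos t ∧ p.src t = Node.var i) = ∅ by
            ext a; simp [hns], card_empty]
    rw [hnew, sum_congr rfl fun t _ => hold t, sum_add_distrib, Fintype.sum_ite_eq']

/-! #### Wires to constants after xor-reconstruction (the readers of `b`, for Case 8) -/

/-- The result is the constant `c` iff the node was that constant, or the node was `I` and
`c = b`. [folklore] -/
theorem _root_.Literature.Computability.Complexity.Node.reroute_eq_const_iff {m : ℕ} (i : Fin n) (I : Fin m)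
    (b : Bool) {u : Node n m} {c : Bool} :
    u.reroute i I b = .const c ↔ u = .const c ∨ (u = .gate I ∧ b = c) := by
  cases u with
  | const c' => simp [Node.reroute]
  | var j => by_cases h : j = i <;> simp [Node.reroute, h]
  | gate k => by_cases h : k = I <;> simp [Node.reroute, h]

/-- The source of a path gate is not `I` (it is `x_i` or an earlier path gate). [folklore] -/
theorem XorPath.src_ne_gate_last (t : Fin (p.len + 1)) : p.src t ≠ .gate I := by
  rcases p.src_eq t with h | ⟨j, -, h⟩
  · rw [h]; exact fun e => by cases e
  · rw [h]; exact fun e => p.gate_castSucc_ne j (Node.gate.inj e)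

/-- **Counting the old wires to a node off the path sources**: the wires from gates off the path,
plus one for each path gate whose other input is the node. [folklore] -/
theorem XorPath.fanout_eq_of_src_ne {v : Node n C.m} (hv : ∀ t, p.src t ≠ v) :
    C.fanout v = (∑ k ∈ univ.filter (fun k => ∀ t, p.gate t ≠ k), (univ.filter fun a : Fin 2 => C.arg k a = v).card)
      + ∑ t, (if p.other t = v then 1 else 0) := by
  classical
  unfold fanout
  rw [p.sum_split fun k => (univ.filter fun a : Fin 2 => C.arg k a = v).card]
  congr 1
  refine sum_congr rfl fun t _ => ?_
  by_cases ho : p.other t = v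
  · rw [if_pos ho, show (univ.filter fun a : Fin 2 => C.arg (p.gate t) a = v) = {(p.pos t).rev} by
      ext a
      simp only [mem_filter, mem_univ, true_and, mem_singleton]
      rcases p.arg_eq_src_or_other t a with ⟨ha, he⟩ | ⟨ha, he⟩
      · rw [he]
        exact ⟨fun h => absurd h (hv t), fun h => absurd (ha.symm.trans h) (fin2_ne_rev _)⟩
      · rw [he]; exact ⟨fun _ => ha, fun _ => ho⟩, card_singleton]
  · rw [if_neg ho, show (univ.filter fun a : Fin 2 => C.arg (p.gate t) a = v) = ∅ by
      ext a
      simp only [mem_filter, mem_univ, true_and, Finset.notMem_empty, iff_false]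
      rcases p.arg_eq_src_or_other t a with ⟨-, he⟩ | ⟨-, he⟩
      · rw [he]; exact hv t
      · rw [he]; exact ho, card_empty]

/-- **Counting the new wires to a node**: the rerouted wires from gates off the path, plus, for
each path gate, its rerouted gate node and its rerouted other input. [folklore] -/
theorem fanout_reroute_eq (v : Node n C.m) :
    (C.reroute p b).fanout v =
      (∑ k ∈ univ.filter (fun k => ∀ t, p.gate t ≠ k), (univ.filter fun a : Fin 2 => (C.arg k a).reroute i I b = v).card)
      + ∑ t, ((if (Node.gate (p.gate t)).reroute i I b = v then 1 else 0)
          + (if (p.other t).reroute i I b = v then 1 else 0)) := by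
  classical
  unfold fanout
  rw [p.sum_split fun k => (univ.filter fun a : Fin 2 => (C.reroute p b).arg k a = v).card]
  congr 1
  · refine sum_congr rfl fun k hk => ?_
    rw [mem_filter] at hk
    congr 1
    refine filter_congr fun a _ => ?_
    rw [reroute_arg_of_not_mem p b hk.2]
  · calc ∑ j, (univ.filter fun a : Fin 2 => (C.reroute p b).arg (p.gate j) a = v).card
        = ∑ j, ((if (Node.gate (p.gate (p.next j))).reroute i I b = v then 1 else 0)
            + (if (p.other (p.next j)).reroute i I b = v then 1 else 0)) := by
          refine sum_congr rfl fun j _ => ?_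
          rw [card_filter, Fin.sum_univ_two]
          congr 1
          · by_cases h : (Node.gate (p.gate (p.next j))).reroute i I b = v
            · rw [if_pos h, if_pos (by rw [reroute_arg_gate_zero]; exact h)]
            · rw [if_neg h, if_neg (by rw [reroute_arg_gate_zero]; exact h)]
          · by_cases h : (p.other (p.next j)).reroute i I b = v
            · rw [if_pos h, if_pos (by rw [reroute_arg_gate_one]; exact h)]
            · rw [if_neg h, if_neg (by rw [reroute_arg_gate_one]; exact h)]
      _ = ∑ t, ((if (Node.gate (p.gate t)).reroute i I b = v then 1 else 0)
            + (if (p.other t).reroute i I b = v then 1 else 0)) :=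
          p.nextEquiv.sum_comp fun t => ((if (Node.gate (p.gate t)).reroute i I b = v then 1 else 0)
            + (if (p.other t).reroute i I b = v then 1 else 0))

/-- **Constants other than `b` keep their readers.** [folklore] -/
theorem fanout_reroute_const_of_ne {c : Bool} (hc : b ≠ c) :
    (C.reroute p b).fanout (.const c) = C.fanout (.const c) := by
  classical
  have hiff : ∀ u : Node n C.m, u.reroute i I b = .const c ↔ u = .const c := fun u => by
    rw [Node.reroute_eq_const_iff]
    exact ⟨fun h => h.elim id fun h' => absurd h'.2 hc, Or.inl⟩
  have hsrc : ∀ t, p.src t ≠ .const c := fun t h => by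
    rcases p.src_eq t with h' | ⟨j, -, h'⟩
    · rw [h'] at h; cases h
    · rw [h'] at h; cases h
  rw [fanout_reroute_eq, p.fanout_eq_of_src_ne hsrc]
  congr 1
  · refine sum_congr rfl fun k _ => ?_
    congr 1
    exact filter_congr fun a _ => hiff _
  · refine sum_congr rfl fun t _ => ?_
    have hg : (Node.gate (p.gate t)).reroute i I b ≠ .const c := fun h => by
      rcases (Node.reroute_eq_const_iff i I b).mp h with h' | ⟨-, h'⟩
      · cases h'
      · exact hc h'
    rw [if_neg hg, zero_add]
    by_cases ho : p.other t = .const c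
    · rw [if_pos ho, if_pos ((hiff _).mpr ho)]
    · rw [if_neg ho, if_neg (fun h => ho ((hiff _).mp h))]

/-- **The readers of `b` after xor-reconstruction**: the old readers of the constant `b`, the old
readers of `I` (now reading the constant `b` that replaces `I`), and one more — the reversed
path equation `I_{k-1} = g_k(b, T_k)` (for a path of one gate, `Z` itself). Li–Yang, Case 8.1.1:
"`Q` … is replaced by a constant `b` feeding at least three gates"; Case 8.1.3: "`b` of
out-degree `2`". [cite: LiYang2022, §4.1 (Case 8.1)] -/
theorem fanout_reroute_const_self :
    (C.reroute p b).fanout (.const b) = C.fanout (.const b) + C.fanout (.gate I) + 1 := by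
  classical
  have hsrc : ∀ t, p.src t ≠ .const b := fun t h => by
    rcases p.src_eq t with h' | ⟨j, -, h'⟩
    · rw [h'] at h; cases h
    · rw [h'] at h; cases h
  rw [fanout_reroute_eq, p.fanout_eq_of_src_ne hsrc, p.fanout_eq_of_src_ne p.src_ne_gate_last]
  -- off the path: `σ(u) = b` iff `u = b` or `u = I`, a disjoint union
  have hoff : ∀ k : Fin C.m, (univ.filter fun a : Fin 2 => (C.arg k a).reroute i I b = .const b).card =
      (univ.filter fun a : Fin 2 => C.arg k a = .const b).card + (univ.filter fun a : Fin 2 => C.arg k a = .gate I).card := by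
    intro k
    rw [← card_union_of_disjoint (disjoint_filter.mpr fun a _ h h' => by rw [h] at h'; cases h')]
    congr 1
    ext a
    simp only [mem_filter, mem_univ, true_and, mem_union, Node.reroute_eq_const_iff, and_true]
  -- on the path: the gate node gives `[t = last]`, the other input gives `[T = b] + [T = I]`
  have hpath : ∀ t : Fin (p.len + 1),
      ((if (Node.gate (p.gate t)).reroute i I b = .const b then 1 else 0)
        + (if (p.other t).reroute i I b = .const b then 1 else 0))
      = ((if p.other t = .const b then 1 else 0) + (if p.other t = .gate I then 1 else 0))
        + (if t = Fin.last p.len then 1 else 0) := by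
    intro t
    have h1 : (if (Node.gate (p.gate t)).reroute i I b = .const b then 1 else 0) = (if t = Fin.last p.len then 1 else 0) := by
      by_cases ht : t = Fin.last p.len
      · rw [if_pos ht, if_pos (by rw [ht, p.gate_last, Node.reroute_gate_self])]
      · rw [if_neg ht, if_neg (by
          rw [Node.reroute_gate_of_ne i I b (fun e => ht ((p.gate_eq_last_iff t).mp e))]
          exact fun h => by cases h)]
    have h2 : (if (p.other t).reroute i I b = .const b then 1 else 0)
        = (if p.other t = .const b then 1 else 0) + (if p.other t = .gate I then 1 else 0) := by
      by_cases ho : p.other t = .const b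
      · rw [if_pos ho, if_pos (by rw [ho]; rfl), if_neg (by rw [ho]; exact fun h => by cases h)]
      · by_cases ho' : p.other t = .gate I
        · rw [if_neg ho, if_pos ho', if_pos (by rw [ho', Node.reroute_gate_self])]
        · rw [if_neg ho, if_neg ho', if_neg (fun h => by
            rcases (Node.reroute_eq_const_iff i I b).mp h with h' | ⟨h', -⟩
            · exact ho h'
            · exact ho' h')]
    rw [h1, h2]
    ring
  rw [sum_congr rfl fun k _ => hoff k, sum_congr rfl fun t _ => hpath t, sum_add_distrib, sum_add_distrib,
    sum_add_distrib, Fintype.sum_ite_eq']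
  ring

/-- In a circuit without wires to constants (e.g. pre-normalized), `b` has exactly
`fanout(I) + 1` wires after xor-reconstruction. [cite: LiYang2022, §4.1 (Case 8.1)] -/
theorem fanout_reroute_const_self_of_no_const (hnc : ∀ k a c, C.arg k a ≠ .const c) :
    (C.reroute p b).fanout (.const b) = C.fanout (.gate I) + 1 := by
  rw [fanout_reroute_const_self, (C.fanout_eq_zero_iff _).mpr fun k a => hnc k a b, zero_add]

/-- **An old reader of `I` off the path reads the constant `b`** at the same position (e.g. the
∧-type gate `G` fed by `Q = I` in Case 8, which is thereby trivialized for the right `b`).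
[cite: LiYang2022, §4.1 (Case 8.1)] -/
theorem reroute_arg_eq_const_of_eq_gate_last {k : Fin C.m} (hk : ∀ j, p.gate j ≠ k) {a : Fin 2}
    (h : C.arg k a = .gate I) : (C.reroute p b).arg k a = .const b := by
  rw [reroute_arg_of_not_mem p b hk, h, Node.reroute_gate_self]

/-- **The reversed last path equation reads the constant `b`**: the slot `prev last` (for a path of
one gate, the slot of `Z = I` itself) has `b` as its first wire. [cite: LiYang2022, §2.6 (display (2))] -/
theorem reroute_arg_prev_last_zero :
    (C.reroute p b).arg (p.gate (p.prev (Fin.last p.len))) 0 = .const b := by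
  rw [reroute_arg_gate_zero, p.next_prev, p.gate_last, Node.reroute_gate_self]

/-! #### Troubled gates and the potential -/

/-- A ⊕-type function is not ∧-type. [folklore] -/
theorem not_isAndOp_of_isXorOp {op : Bool → Bool → Bool} (h : IsXorOp op) : ¬ IsAndOp op := by
  rintro ⟨c₁, c₂, c₃, ha⟩
  obtain ⟨c, hc⟩ := h
  have h00 := (ha false false).symm.trans (hc false false)
  have h01 := (ha false true).symm.trans (hc false true)
  have h10 := (ha true false).symm.trans (hc true false)
  have h11 := (ha true true).symm.trans (hc true true)
  revert h00 h01 h10 h11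
  cases c₁ <;> cases c₂ <;> cases c₃ <;> cases c <;> simp

/-- An ∧-type gate of the new circuit is off the path. [folklore] -/
theorem not_mem_of_isAndOp {k : Fin C.m} (hk : IsAndOp ((C.reroute p b).op k)) : ∀ j, p.gate j ≠ k := by
  intro j e
  subst e
  rw [reroute_op_gate] at hk
  exact not_isAndOp_of_isXorOp (C.isXorOp_of_mem _ (p.mem_xorPart _)) hk

/-- An ∧-type gate of `C` is off the path and keeps its function. [folklore] -/
theorem reroute_op_of_isAndOp {k : Fin C.m} (hk : IsAndOp (C.op k)) :
    (∀ j, p.gate j ≠ k) ∧ (C.reroute p b).op k = C.op k := by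
  have h : ∀ j, p.gate j ≠ k := fun j e =>
    not_isAndOp_of_isXorOp (C.isXorOp_of_mem _ (p.mem_xorPart j)) (e ▸ hk)
  exact ⟨h, reroute_op_of_not_mem p b h⟩

/-- **Xor-reconstruction creates no troubled gate**: a troubled gate of `C[I := b]` was troubled
in `C`, lies off the path and keeps its wires (an ∧-type gate is off the path; its new wires are
variables, hence its old wires, to variables other than `x_i`; out-degrees of such nodes are
unchanged). Li–Yang, Case 8.1.1: "we remove the gate `Q` while adding a new gate `Z`, without
introducing any new troubled gates". [cite: LiYang2022, §4.1 (Case 8.1.1)] -/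
theorem troubled_of_troubled_reroute {k : Fin C.m} (hT : (C.reroute p b).Troubled k) :
    C.Troubled k ∧ (∀ j, p.gate j ≠ k) ∧ ∀ a, (C.reroute p b).arg k a = C.arg k a := by
  obtain ⟨hand, h1, x, y, hxy, hr, hx, hy⟩ := hT
  have hk := not_mem_of_isAndOp p b hand
  rw [reroute_op_of_not_mem p b hk] at hand
  -- each new wire is a variable other than `x_i`, and equals the old wire
  have hargs : ∀ a, (C.reroute p b).arg k a = C.arg k a ∧ ∃ z, C.arg k a = .var z ∧ z ≠ i := by
    intro a
    have hmem : (C.reroute p b).arg k a ∈ Set.range ((C.reroute p b).arg k) := ⟨a, rfl⟩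
    rw [hr] at hmem
    have hva : ∃ z, (C.reroute p b).arg k a = .var z := by
      rcases hmem with h | h
      · exact ⟨x, h⟩
      · exact ⟨y, h⟩
    obtain ⟨z, hz⟩ := hva
    rw [reroute_arg_of_not_mem p b hk] at hz ⊢
    obtain ⟨e, hne⟩ := (Node.reroute_eq_var_iff i I b).mp hz
    exact ⟨hz.trans e.symm, z, e, hne⟩
  have harg : (C.reroute p b).arg k = C.arg k := funext fun a => (hargs a).1
  have hvar : ∀ z, (∃ a, C.arg k a = .var z) → z ≠ i := by
    rintro z ⟨a, ha⟩
    obtain ⟨-, z', hz', hne⟩ := hargs a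
    rw [ha] at hz'; cases hz'; exact hne
  have hxr : ∃ a, C.arg k a = .var x := by
    have : Node.var x ∈ Set.range (C.arg k) := by rw [← harg, hr]; exact Set.mem_insert _ _
    exact this
  have hyr : ∃ a, C.arg k a = .var y := by
    have : Node.var y ∈ Set.range (C.arg k) := by rw [← harg, hr]; exact Set.mem_insert_of_mem _ rfl
    exact this
  refine ⟨⟨hand, ?_, x, y, hxy, by rw [← harg]; exact hr, ?_, ?_⟩, hk, fun a => (hargs a).1⟩
  · rw [← fanout_reroute_of_generic p b (v := .gate k) (by simp) (fun t e => hk t (Node.gate.inj e).symm) (by simp)]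
    exact h1
  · rw [← fanout_reroute_of_generic p b (v := .var x) (fun e => hvar x hxr (Node.var.inj e)) (by simp) (by simp)]
    exact hx
  · rw [← fanout_reroute_of_generic p b (v := .var y) (fun e => hvar y hyr (Node.var.inj e)) (by simp) (by simp)]
    exact hy

/-- The number of troubled gates does not increase. [cite: LiYang2022, §4.1 (Case 8.1.1)] -/
theorem troubledCount_reroute_le : (C.reroute p b).troubledCount ≤ C.troubledCount := by
  classical
  unfold troubledCount
  refine card_le_card fun k hk => ?_
  simp only [mem_filter, mem_univ, true_and] at hk ⊢
  exact (troubled_of_troubled_reroute p b hk).1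

/-- **A packing survives with no larger potential** ("the potential remains unchanged" for the
empty packing): the packs whose gates stay troubled. [cite: LiYang2022, §4.1 (Case 8.1.1)] -/
theorem exists_packing_reroute {P : Finset (Fin C.m × Fin C.m)} (hP : C.IsPacking P) :
    ∃ P' : Finset (Fin C.m × Fin C.m), (C.reroute p b).IsPacking P' ∧
      (C.reroute p b).potential P' ≤ C.potential P := by
  have h := exists_packing_transfer C (C.reroute p b) id Function.injective_id hP
    (fun q _ => ⟨⟨q.1, rfl⟩, ⟨q.2, rfl⟩⟩)
    (fun k k' hk hk' _ _ hadj => by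
      obtain ⟨z, ⟨a, ha⟩, ⟨a', ha'⟩⟩ := hadj
      exact ⟨z, ⟨a, ((troubled_of_troubled_reroute p b hk).2.2 a).trans ha⟩,
        ⟨a', ((troubled_of_troubled_reroute p b hk').2.2 a').trans ha'⟩⟩)
    ∅ ∅ (fun k hk hnot => absurd (troubled_of_troubled_reroute p b hk).1 hnot)
    (Or.inl (by simp)) (Or.inl (by simp))
  obtain ⟨P', hP', hle⟩ := h
  refine ⟨P', hP', ?_⟩
  simpa using hle

/-! #### Influential inputs -/

/-- **Influential inputs after xor-reconstruction**: among the old ones other than `x_i`, for a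
new source in which `x_i` is not free and no new variable is protected. [cite: LiYang2022, Def. 3.6] -/
theorem influential_reroute_subset {R R' : RdqSource n} (hfree : ¬ R'.Free i)
    (hprot : ∀ j, R'.Protected j → R.Protected j) :
    (C.reroute p b).influential R' ⊆ (C.influential R).erase i := by
  classical
  intro j hj
  unfold influential at hj ⊢
  simp only [mem_filter, mem_univ, true_and, mem_erase] at hj ⊢
  by_cases hji : j = i
  · subst hji
    exfalso
    rcases hj with h | h
    · rw [fanout_reroute_var_self] at h; exact absurd h (by norm_num)
    · exact hfree h.1
  · refine ⟨hji, hj.imp (fun h => ?_) (hprot j)⟩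
    by_contra h0
    push Not at h0
    have := fanout_reroute_var_eq_zero p b (j := j) (by omega)
    omega

end Reroute

/-! ### The source side: the affine equation of the gate `I`, and `f|_{R'}` -/

section Source

variable {C} {i : Fin n} {I : Fin C.m} (hF : C.Fair)

/-- The gates of the xor-part compute xor-affine functions of the input (`GateEliminationClosed`).
[cite: LiYang2022, §2.6] -/
theorem xorAffine_gate (hI : I ∈ C.xorPart) : IsXorAffine fun x => C.sol hF x I :=
  C.sol_xorAffine_of_closed_affine hF C.isClosed_xorPart (fun k hk => (C.isXorOp_of_mem k hk).isAffineOp) hI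

/-- If no gate reads `x_s`, the gate equations do not see `x_s`. [folklore] -/
theorem consistent_update_iff_of_fanout_eq_zero {s : Fin n} (h0 : C.fanout (.var s) = 0)
    (x : Fin n → Bool) (t : Bool) (w : Fin C.m → Bool) :
    C.Consistent (Function.update x s t) w ↔ C.Consistent x w := by
  have hns : ∀ k a, C.arg k a ≠ .var s := fun k a e => (fanout_pos_of_arg_eq e).ne' h0
  have hin : ∀ k a, C.nodeVal (Function.update x s t) w (C.arg k a) = C.nodeVal x w (C.arg k a) := by
    intro k a
    cases h : C.arg k a with
    | const c => rfl
    | var j =>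
      have hj : j ≠ s := fun e => hns k a (by rw [h, e])
      exact Function.update_of_ne hj _ _
    | gate k' => rfl
  unfold Consistent
  simp only [hin]

/-- Hence the solution does not depend on `x_s`. [folklore] -/
theorem sol_update_of_fanout_eq_zero {s : Fin n} (h0 : C.fanout (.var s) = 0) (x : Fin n → Bool) (t : Bool) :
    C.sol hF (Function.update x s t) = C.sol hF x :=
  (((C.consistent_update_iff_of_fanout_eq_zero h0 x t _).mpr (C.consistent_sol hF x)).eq_sol hF).symm

/-- The **support** of the affine function computed at `I`: the variables `x_s` whose basis vector
is sent to `1` by its linear part. [cite: LiYang2022, §2.6] -/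
noncomputable def gateSupport (hI : I ∈ C.xorPart) : Finset (Fin n) :=
  univ.filter fun s => (C.xorAffine_gate hF hI).linearPart (fun j => if s = j then 1 else 0) = 1

/-- The linear part on a basis vector records whether flipping `x_s` (at the zero input) flips
`I`. [folklore] -/
theorem linearPart_single (hI : I ∈ C.xorPart) (s : Fin n) :
    (C.xorAffine_gate hF hI).linearPart (fun j => if s = j then 1 else 0) =
      boolToZMod2 (C.sol hF (Function.update (fun _ => false) s true) I ^^ C.sol hF (fun _ => false) I) := by
  show boolToZMod2 (C.sol hF (boolOfZMod2.symm _) I ^^ _) = _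
  have hx : boolOfZMod2.symm (fun j => if s = j then (1 : ZMod 2) else 0) = Function.update (fun _ => false) s true := by
    funext j
    rw [Circuit.boolOfZMod2_symm_apply]
    by_cases h : s = j
    · subst h; rw [if_pos rfl, Function.update_self]; decide
    · rw [if_neg h, Function.update_of_ne (Ne.symm h)]; decide
  rw [hx]

/-- Membership in the support: flipping `x_s` at the zero input flips `I`. [folklore] -/
theorem mem_gateSupport_iff (hI : I ∈ C.xorPart) (s : Fin n) :
    s ∈ C.gateSupport hF hI ↔ C.sol hF (Function.update (fun _ => false) s true) I ≠ C.sol hF (fun _ => false) I := by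
  unfold gateSupport
  rw [mem_filter, C.linearPart_single hF hI s]
  simp only [mem_univ, true_and]
  generalize C.sol hF (Function.update (fun _ => false) s true) I = α
  generalize C.sol hF (fun _ => false) I = β
  cases α <;> cases β <;> decide

/-- A variable on which `I` depends lies in the support. [cite: LiYang2022, Prop. 2.7] -/
theorem mem_gateSupport_of_dependsOn (hI : I ∈ C.xorPart) (hdep : C.DependsOn hF I i) : i ∈ C.gateSupport hF hI :=
  (C.mem_gateSupport_iff hF hI i).mpr (hdep fun _ => false)

/-- A variable of the support is read by some gate. [folklore] -/
theorem fanout_pos_of_mem_gateSupport (hI : I ∈ C.xorPart) {s : Fin n} (hs : s ∈ C.gateSupport hF hI) :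
    0 < C.fanout (.var s) := by
  rw [C.mem_gateSupport_iff hF hI] at hs
  by_contra h0
  push Not at h0
  exact hs (by rw [C.sol_update_of_fanout_eq_zero hF (Nat.le_zero.mp h0)])

/-- **The linear part is the sum over the support.** [folklore] -/
theorem linearPart_eq_sum (hI : I ∈ C.xorPart) (v : Fin n → ZMod 2) :
    (C.xorAffine_gate hF hI).linearPart v = ∑ s ∈ C.gateSupport hF hI, v s := by
  classical
  set φ := (C.xorAffine_gate hF hI).linearPart with hφ
  rw [LinearMap.pi_apply_eq_sum_univ φ v, ← sum_filter_add_sum_filter_not univ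
    (fun s => φ (fun j => if s = j then 1 else 0) = 1)]
  have h1 : ∑ s ∈ univ.filter (fun s => φ (fun j => if s = j then 1 else 0) = 1),
      v s • φ (fun j => if s = j then 1 else 0) = ∑ s ∈ C.gateSupport hF hI, v s := by
    refine sum_congr rfl fun s hs => ?_
    rw [(mem_filter.mp hs).2, smul_eq_mul, mul_one]
  have h2 : ∑ s ∈ univ.filter (fun s => ¬ φ (fun j => if s = j then 1 else 0) = 1),
      v s • φ (fun j => if s = j then 1 else 0) = 0 := by
    refine sum_eq_zero fun s hs => ?_
    have hne := (mem_filter.mp hs).2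
    have h0 : φ (fun j => if s = j then 1 else 0) = 0 := by
      have : ∀ z : ZMod 2, ¬ z = 1 → z = 0 := by decide
      exact this _ hne
    rw [h0, smul_zero]
  rw [h1, h2, add_zero]

variable (b : Bool)

/-- **The affine equation `I = b` solved for `x_i`**: `x_i = ⊕_{s ∈ S ∖ {i}} x_s ⊕ (b ⊕ I(0))`
(Li–Yang §2.6: "making `x_i` a linear variable with proper affine equation").
[cite: LiYang2022, §2.6] -/
noncomputable def gateLinEq (hI : I ∈ C.xorPart) (i : Fin n) : LinEq n :=
  ⟨(C.gateSupport hF hI).erase i, boolToZMod2 (b ^^ C.sol hF (fun _ => false) I)⟩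

/-- **The equation is equivalent to `I = b`** (for `i` in the support). [cite: LiYang2022, §2.6] -/
theorem eval_gateLinEq_iff (hI : I ∈ C.xorPart) (hi : i ∈ C.gateSupport hF hI) (v : Fin n → ZMod 2) :
    v i = (C.gateLinEq hF b hI i).eval v ↔ C.sol hF (boolOfZMod2.symm v) I = b := by
  have happ := (C.xorAffine_gate hF hI).apply_eq v
  rw [C.linearPart_eq_sum hF hI, ← add_sum_erase _ _ hi] at happ
  rw [happ]
  unfold gateLinEq LinEq.eval
  simp only
  generalize ∑ s ∈ (C.gateSupport hF hI).erase i, v s = c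
  generalize C.sol hF (fun _ => false) I = g₀
  have hvi : v i = 0 ∨ v i = 1 := by generalize v i = z; revert z; decide
  have hc : c = 0 ∨ c = 1 := by revert c; decide
  rcases hvi with h | h <;> rcases hc with h' | h' <;> rw [h, h'] <;> revert b g₀ <;> decide

variable {f : (Fin n → ZMod 2) → Bool} {R : RdqSource n}

/-- The right-hand side of the equation consists of free variables other than `x_i` (they are read
by gates, and non-free variables are `0`-variables). [cite: LiYang2022, §2.6] -/
theorem gateLinEq_wf (hC : C.ComputesRestr f R) (hI : I ∈ C.xorPart) :
    ∀ s ∈ (C.gateLinEq hF b hI i).support, R.lin s = none ∧ s ≠ i := by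
  intro s hs
  obtain ⟨hsi, hs⟩ := mem_erase.mp hs
  have hfree : R.Free s := by
    by_contra hns
    exact (C.fanout_pos_of_mem_gateSupport hF hI hs).ne' (hC.1 s hns)
  exact ⟨hfree.1, hsi⟩

/-- A variable read by a gate is free. [cite: LiYang2022, §2.3] -/
theorem free_of_fanout_pos (hC : C.ComputesRestr f R) {s : Fin n} (hs : 0 < C.fanout (.var s)) : R.Free s := by
  by_contra hns
  exact hs.ne' (hC.1 s hns)

/-- **The restricted source `R'` of the constant substitution to the gate `I`**: `x_i` (free, read
by the path, unprotected) becomes linear with the equation `gateLinEq` (Li–Yang §2.6, via the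
affine substitution `RdqSource.assignLin` of §2.4). [cite: LiYang2022, §2.6] -/
noncomputable def rerouteSource (hC : C.ComputesRestr f R) (p : C.XorPath i I) (hip : ¬ R.Protected i) :
    RdqSource n :=
  R.assignLin i (C.gateLinEq hF b p.last_mem_xorPart i) (C.free_of_fanout_pos hC p.one_le_fanout_var) hip
    (C.gateLinEq_wf hF b hC p.last_mem_xorPart)

variable {b hF}
variable (hC : C.ComputesRestr f R) (p : C.XorPath i I) (hip : ¬ R.Protected i)

/-- `x_i` is no longer free; the other free variables are kept. [cite: LiYang2022, §2.6] -/
theorem free_rerouteSource_iff (j : Fin n) : (C.rerouteSource hF b hC p hip).Free j ↔ R.Free j ∧ j ≠ i :=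
  RdqSource.free_assignLin_iff _ _ _ j

/-- **One substitution**: `dim R' + 1 = dim R`. [cite: LiYang2022, §2.6] -/
theorem dim_rerouteSource : (C.rerouteSource hF b hC p hip).dim + 1 = R.dim :=
  RdqSource.dim_assignLin _ _ _

/-- No quadratic equation is touched. [cite: LiYang2022, §2.6] -/
@[simp] theorem quadCount_rerouteSource : (C.rerouteSource hF b hC p hip).quadCount = R.quadCount := rfl

/-- The protected variables are unchanged. [cite: LiYang2022, §2.6] -/
theorem protected_rerouteSource_iff (j : Fin n) : (C.rerouteSource hF b hC p hip).Protected j ↔ R.Protected j :=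
  RdqSource.protected_assignLin_iff _ _ _ j

/-- **Solutions of `R'`**: the solutions of `R` on which `I = b`. [cite: LiYang2022, §2.6, Prop. 2.8] -/
theorem mem_sol_rerouteSource_iff (hdep : C.DependsOn hF I i) (v : Fin n → ZMod 2) :
    v ∈ (C.rerouteSource hF b hC p hip).Sol ↔ v ∈ R.Sol ∧ C.sol hF (boolOfZMod2.symm v) I = b := by
  unfold rerouteSource
  rw [RdqSource.mem_sol_assignLin_iff, C.eval_gateLinEq_iff hF b p.last_mem_xorPart
    (C.mem_gateSupport_of_dependsOn hF p.last_mem_xorPart hdep)]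

/-- **`C[I := b]` computes `f|_{R'}`** (Li–Yang §2.6: "perform xor-reconstruction to `C` to obtain
`C'` computing `f|_{R'}`"): `x_i` is a `0`-variable, the other non-free variables stay
`0`-variables; on a solution `v` of `R'` (so `I(v) = b`) the unique solution of the new circuit is
the old solution with `Z := v_i` (the other value of `x_i` would give `I ≠ b` by dependence), and
every node — in particular the output — keeps its value. [cite: LiYang2022, §2.6, Prop. 2.8] -/
theorem ComputesRestr.reroute (hdep : C.DependsOn hF I i) (b : Bool) :
    (C.reroute p b).ComputesRestr f (C.rerouteSource hF b hC p hip) := by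
  refine ⟨fun j hj => ?_, fun v hv w' hw' => ?_⟩
  · by_cases hji : j = i
    · subst hji; exact fanout_reroute_var_self p b
    · refine fanout_reroute_var_eq_zero p b (hC.1 j fun hfj => hj ?_)
      exact (C.free_rerouteSource_iff hC p hip j).mpr ⟨hfj, hji⟩
  · obtain ⟨hvR, hvb⟩ := (C.mem_sol_rerouteSource_iff hC p hip hdep v).mp hv
    rw [consistent_reroute_iff] at hw'
    set x' := boolOfZMod2.symm v with hx'
    have hw : Function.update w' I b = C.sol hF (Function.update x' i (w' I)) := hw'.eq_sol hF
    have hxb : C.sol hF (Function.update x' i (w' I)) I = b := by rw [← hw, Function.update_self]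
    have hxi : Function.update x' i (w' I) = x' := by
      by_contra hne
      have e : w' I = !x' i := by
        have : w' I ≠ x' i := fun e => hne (by rw [e, Function.update_eq_self])
        revert this; generalize w' I = α; generalize x' i = β; cases α <;> cases β <;> decide
      rw [e] at hxb
      exact hdep x' (hxb.trans hvb.symm)
    rw [hxi] at hw'
    show (C.reroute p b).nodeVal x' w' (C.out.reroute i I b) = f v
    rw [nodeVal_reroute_eq, nodeVal_reroute, hxi]
    exact hC.2 v hvR _ hw'

/-- **The measure after the constant substitution to a gate**: with a surviving packing,
`μ(C[I := b], 𝒫', R') ≤ μ(C, 𝒫, R) - α_I` — as many gates, `Φ' ≤ Φ`, `q' = q`, and the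
influential inputs lose `x_i` (a `1⁺`-variable before, a non-free `0`-variable after) and gain
nothing. [cite: LiYang2022, Def. 3.6, §2.6, §4.1 (Case 8.1)] -/
theorem measure_reroute_le {αφ αI : ℝ} (hφ : 0 ≤ αφ) (hαI : 0 ≤ αI) (αQ : ℝ)
    {P : Finset (Fin C.m × Fin C.m)} (hP : C.IsPacking P) (b : Bool) :
    ∃ P' : Finset (Fin C.m × Fin C.m), (C.reroute p b).IsPacking P' ∧
      (C.reroute p b).measure αφ αI αQ P' (C.rerouteSource hF b hC p hip) ≤ C.measure αφ αI αQ P R - αI := by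
  classical
  obtain ⟨P', hP', hpot⟩ := exists_packing_reroute p b hP
  refine ⟨P', hP', ?_⟩
  have hsub : (C.reroute p b).influential (C.rerouteSource hF b hC p hip) ⊆ (C.influential R).erase i :=
    influential_reroute_subset p b (fun h => ((C.free_rerouteSource_iff hC p hip i).mp h).2 rfl)
      fun j hj => (C.protected_rerouteSource_iff hC p hip j).mp hj
  have hi : i ∈ C.influential R := by
    unfold influential
    exact mem_filter.mpr ⟨mem_univ _, Or.inl p.one_le_fanout_var⟩
  have hcard : ((C.reroute p b).influential (C.rerouteSource hF b hC p hip)).card + 1 ≤ (C.influential R).card := by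
    have h1 := card_le_card hsub
    rw [card_erase_of_mem hi] at h1
    have h2 := card_pos.mpr ⟨i, hi⟩
    omega
  have hc : (((C.reroute p b).influential (C.rerouteSource hF b hC p hip)).card : ℝ) + 1 ≤ (C.influential R).card := by
    exact_mod_cast hcard
  unfold measure
  rw [quadCount_rerouteSource]
  have hm : ((C.reroute p b).m : ℝ) = C.m := rfl
  rw [hm]
  nlinarith

/-- **Constant substitution to a gate, assembled** (Li–Yang §2.6 with Prop. 2.7, Prop. 2.8): for a
fair semicircuit `C` computing `f|_R` with a packing `𝒫`, a gate `I` of the xor-part depending on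
an unprotected variable `x_i`, and a constant `b`, the xor-reconstruction `C[I := b]` along a path
from `x_i` to `I` is a fair semicircuit computing `f|_{R'}` for a source `R'` with one free variable
fewer, the same quadratic equations and protected variables, and, for a suitable packing `𝒫'`,
`μ(C[I := b], 𝒫', R') ≤ μ(C, 𝒫, R) - α_I`. (The gates now fed by the constant `b` — the readers
of `I` — are eliminated afterwards by the normalization rules, Case 8 of §4.1.)
[cite: LiYang2022, §2.6, Prop. 2.8] -/
theorem xor_reconstruction (hF : C.Fair) (hC : C.ComputesRestr f R) {P : Finset (Fin C.m × Fin C.m)}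
    (hP : C.IsPacking P) (p : C.XorPath i I) (hdep : C.DependsOn hF I i) (hip : ¬ R.Protected i) (b : Bool)
    {αφ αI : ℝ} (hφ : 0 ≤ αφ) (hαI : 0 ≤ αI) (αQ : ℝ) :
    ∃ P' : Finset (Fin C.m × Fin C.m),
      (C.reroute p b).Fair ∧ (C.reroute p b).ComputesRestr f (C.rerouteSource hF b hC p hip) ∧
        (C.reroute p b).IsPacking P' ∧ (C.rerouteSource hF b hC p hip).dim + 1 = R.dim ∧
        (C.rerouteSource hF b hC p hip).quadCount = R.quadCount ∧
        (∀ j, (C.rerouteSource hF b hC p hip).Protected j ↔ R.Protected j) ∧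
        (C.reroute p b).measure αφ αI αQ P' (C.rerouteSource hF b hC p hip) ≤ C.measure αφ αI αQ P R - αI := by
  obtain ⟨P', hP', hμ⟩ := C.measure_reroute_le hC p hip hφ hαI αQ hP b
  exact ⟨P', hF.reroute p b hdep, ComputesRestr.reroute hC p hip hdep b, hP', C.dim_rerouteSource hC p hip,
    C.quadCount_rerouteSource hC p hip, C.protected_rerouteSource_iff hC p hip, hμ⟩

/-- The same, with the path supplied by Prop. 2.7 from the dependence. [cite: LiYang2022, §2.6, Prop. 2.7, Prop. 2.8] -/
theorem exists_xor_reconstruction (hF : C.Fair) (hC : C.ComputesRestr f R) {P : Finset (Fin C.m × Fin C.m)}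
    (hP : C.IsPacking P) (hI : I ∈ C.xorPart) (hdep : C.DependsOn hF I i) (hip : ¬ R.Protected i) (b : Bool)
    {αφ αI : ℝ} (hφ : 0 ≤ αφ) (hαI : 0 ≤ αI) (αQ : ℝ) :
    ∃ (p : C.XorPath i I) (P' : Finset (Fin C.m × Fin C.m)),
      (C.reroute p b).Fair ∧ (C.reroute p b).ComputesRestr f (C.rerouteSource hF b hC p hip) ∧
        (C.reroute p b).IsPacking P' ∧ (C.rerouteSource hF b hC p hip).dim + 1 = R.dim ∧
        (C.reroute p b).measure αφ αI αQ P' (C.rerouteSource hF b hC p hip) ≤ C.measure αφ αI αQ P R - αI := by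
  obtain ⟨p⟩ := C.exists_xorPath hF hI hdep
  obtain ⟨P', h1, h2, h3, h4, -, -, h5⟩ := C.xor_reconstruction hF hC hP p hdep hip b hφ hαI αQ
  exact ⟨p, P', h1, h2, h3, h4, h5⟩

end Source

end Semicircuit

end Literature.Computability.Complexity
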